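import Mathlib
import Summits.ValiantsHypothesis.ValiantsHypothesis.Theorems.LacunarySymmetroidMatrixDescartesCensusDefs
import Summits.ValiantsHypothesis.ValiantsHypothesis.Theorems.LacunarySymmetroidMatrixDescartesCensusChamberTableB

/-!
# Route `LacunarySymmetroid`, crux `DoorA26` (stmt-ValiantsHypothesis-19979): the registered stub STATEMENTS of the line `census`

`Defs` file (D-0016 `<Route><Crux>Defs` convention; precedent `Summits/QuantumAdvantage/QuantumAdvantage/Theorems/SosSandwichTransferPBDefs.lean`)
of the crux skeleton `Summits/ValiantsHypothesis/ValiantsHypothesis/Cruxes/DoorA26/Lines/census.lean` (sha `1fb9861a1feadc1e…`, registrar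
`planner-cruxplan-stmt-ValiantsHypothesis-19979-census-g0`, four registered stubs `stub_chamberCover`, `stub_easyChambers`, `stub_w4Band`,
`stub_hardChambers`, each registered with the one-line signature `Stmt.stub_<name>`).  A `Cruxes/…/Lines/*.lean` skeleton is not an importable
module, so the STATEMENTS of its registered stubs live here — copied VERBATIM (character for character) from the skeleton, in the SAME namespace
`Summit.ValiantsHypothesis.ValiantsHypothesis.Cruxes.DoorA26.Census` and under the SAME names — to be imported by the stub files
`Theorems/LacunarySymmetroidDoorA26Stub<Name>.lean` (landed `--supports stmt-ValiantsHypothesis-19979`, each proving `stub_<name> : Stmt.stub_<name>`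
by name) and, at the end, by the closing composition.  The skeleton's statements are written over the TABLE BLOCK names `Census.chamber` (now the
tree module `…CensusChamberTableA/B`, verbatim the block) and the closed `Prop` `W4BandLaw`; the table files deliberately omit `W4BandLaw`
(see the header of `…CensusChamberTableB`), so it is declared HERE, verbatim the skeleton's lines 1290–1305, inside this namespace.
RE-POINTING THE SKELETON (line owner, one edit, zero renaming of stubs): delete the TABLE BLOCK, `import` `…CensusChamberTableB` and this module,
delete the local `def Stmt.stub_*` copies (and the local `W4BandLaw`, dropping it from the `open … (chamber W4BandLaw …)` clause — this
namespace's `W4BandLaw` is then in scope unqualified), and import the landed stub files in place of the `sorry`s.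

Nothing open is asserted: every `def … : Prop` below is a STATEMENT (a registered stub signature of this route's crux, or the band-law `Prop`
that two of them mention), consumed only as the type of a stub theorem or as an explicit hypothesis.  No theorem is proved here.  These are
registered stub SIGNATURES of the crux line, not literature facts (no citation exists or is needed).  `DoorA26` (`= PosRootLawAt 2 6 19`)
stays OPEN; the census registers are unchanged (`ζ_sym(2,6) ∈ {18,19,20}`, 18 attained, never > 18); nothing here bears on `MatrixDescartes`
(stmt-ValiantsHypothesis-18050) or on `VP ≠ VNP`.

Contents (verbatim from the skeleton; the skeleton's docstrings abridged):
* `W4BandLaw` — the WINDOW-4 BAND LAW in witness-free algebraic form (content PROVED in the tree: `Census.w4BandLaw_holds`,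
  `…CensusWindowFourBandLaw`, verbatim this statement);
* `Stmt.stub_chamberCover` — completeness of the 2 608-chamber table `Census.chamber` (content PROVED in the tree: `Census.chamberCover`,
  `…CensusChamberCover`, verbatim this statement);
* `Stmt.stub_easyChambers` — the 2 604 non-hard chambers carry the door-A row `PosRootLawOn 2 6 19 d` (OPEN as a whole; many instances landed as
  `Census.doorA26_on_chamber<n>`);
* `Stmt.stub_w4Band := W4BandLaw`;
* `Stmt.stub_hardChambers := W4BandLaw →` the door-A row on the hard chambers `[1, 954, 1706, 1709]` (OPEN — the crux of the line).

Deliberately NOT here: any proof of a stub (separate files, one per stub), the sorried `stub_*` placeholders, the composition `DoorA26_of` /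
`DoorA26_proof` of the skeleton (they stay under `Cruxes/` until the last stub closes).
-/

-- `Summit.ValiantsHypothesis.ValiantsHypothesis.…` repeats a component by the D-0017 layout
-- (single-conjunct summit), which the `dupNamespace` linter flags; the name is mandated.
set_option linter.dupNamespace false

namespace Summit.ValiantsHypothesis.ValiantsHypothesis.Cruxes.DoorA26.Census

open Summit.ValiantsHypothesis.ValiantsHypothesis.Theorems.LacunarySymmetroidMatrixDescartes (PosRootLawOn)
open Summit.ValiantsHypothesis.ValiantsHypothesis.Theorems.LacunarySymmetroidMatrixDescartes.Census (chamber)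

/-- **WINDOW-4 BAND LAW** (typed witness-free; a named `Prop`, nothing asserted — verbatim the skeleton's `W4BandLaw`, the statement of the
registered stub `stub_w4Band`; its content is the tree theorem `Census.w4BandLaw_holds`).  With `T₂(x) = u·b − (u+v)·c·x^v + (u+v+w)·e·x^(v+w)`,
`T₁(x) = (u+v+w)·a − (v+w)·b·x^u + w·c·x^(u+v)` and `Φ(x) = u·a − v·c·x^(u+v) + (v+w)·e·x^(u+v+w)`: HYPOTHESIS `0 < s₁ < s₂`,
`T₂(s₁) = T₂(s₂) = 0`, `T₁(s₁) < 0 < T₁(s₂)`; CONCLUSION at any test abscissa `t > 0`: left of centre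
(`(v+w)(u+v+w)·e·t^w ≤ v(u+v)·c`) `T₂(t) ≤ 0 ⟹ Φ(t) < 0`, right of centre `Φ(t) ≤ 0 ⟹ T₂(t) < 0`.  A registered stub SIGNATURE's body, not a
literature fact. -/
def W4BandLaw : Prop :=
  ∀ (u v w : ℕ), 0 < u → 0 < v → 0 < w →
  ∀ (a b c e : ℝ), 0 < c → 0 < e →
  ∀ (s₁ s₂ : ℝ), 0 < s₁ → s₁ < s₂ →
    (u : ℝ) * b - ((u : ℝ) + v) * c * s₁ ^ v + ((u : ℝ) + v + w) * e * s₁ ^ (v + w) = 0 →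
    (u : ℝ) * b - ((u : ℝ) + v) * c * s₂ ^ v + ((u : ℝ) + v + w) * e * s₂ ^ (v + w) = 0 →
    ((u : ℝ) + v + w) * a - ((v : ℝ) + w) * b * s₁ ^ u + (w : ℝ) * c * s₁ ^ (u + v) < 0 →
    0 < ((u : ℝ) + v + w) * a - ((v : ℝ) + w) * b * s₂ ^ u + (w : ℝ) * c * s₂ ^ (u + v) →
    ∀ t : ℝ, 0 < t →
      ((((v : ℝ) + w) * ((u : ℝ) + v + w) * e * t ^ w ≤ (v : ℝ) * ((u : ℝ) + v) * c →
          (u : ℝ) * b - ((u : ℝ) + v) * c * t ^ v + ((u : ℝ) + v + w) * e * t ^ (v + w) ≤ 0 →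
            (u : ℝ) * a - (v : ℝ) * c * t ^ (u + v) + ((v : ℝ) + w) * e * t ^ (u + v + w) < 0) ∧
        ((v : ℝ) * ((u : ℝ) + v) * c ≤ ((v : ℝ) + w) * ((u : ℝ) + v + w) * e * t ^ w →
          (u : ℝ) * a - (v : ℝ) * c * t ^ (u + v) + ((v : ℝ) + w) * e * t ^ (u + v + w) ≤ 0 →
            (u : ℝ) * b - ((u : ℝ) + v) * c * t ^ v + ((u : ℝ) + v + w) * e * t ^ (v + w) < 0))


/-- `Stmt.stub_chamberCover` (registered stub `stub_chamberCover`) — **COMPLETENESS OF THE TABLE**: for every sorted generic support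
`0 = d₀ < d₁ < ⋯ < d₅` (generic = some covering order `σ` of the 21 canonical pairs has strictly increasing pair sums) the pair-sum order is one of
the 2 608 listed orders `Census.chamber n`, `n < 2608`.  Verbatim the skeleton's statement (its content is the tree theorem
`Census.chamberCover`).  A registered stub SIGNATURE, not a literature fact. -/
def Stmt.stub_chamberCover : Prop :=
    ∀ d : Fin 6 → ℕ, StrictMono d → d 0 = 0 →
      ∀ σ : Fin 21 → Fin 6 × Fin 6, (∀ p : Fin 6 × Fin 6, ∃ t : Fin 21, σ t = p ∨ σ t = p.swap) →
        StrictMono ((fun p : Fin 6 × Fin 6 => d p.1 + d p.2) ∘ σ) →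
          ∃ n < 2608, StrictMono ((fun p : Fin 6 × Fin 6 => d p.1 + d p.2) ∘ chamber n)

/-- `Stmt.stub_easyChambers` (registered stub `stub_easyChambers`) — **THE 2 604 NON-HARD CHAMBERS CARRY THE DOOR-A ROW**: for every listed
chamber `n ∉ [1, 954, 1706, 1709]` and every support `d` in it, `PosRootLawOn 2 6 19 d`.  Verbatim the skeleton's statement; OPEN as a whole
(instances land as `Census.doorA26_on_chamber<n>`).  A registered stub SIGNATURE, not a literature fact. -/
def Stmt.stub_easyChambers : Prop :=
    ∀ n < 2608, n ∉ [1, 954, 1706, 1709] →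
      ∀ d : Fin 6 → ℕ, StrictMono ((fun p : Fin 6 × Fin 6 => d p.1 + d p.2) ∘ chamber n) → PosRootLawOn 2 6 19 d

/-- `Stmt.stub_w4Band` (registered stub `stub_w4Band`) — **THE WINDOW-4 BAND LAW HOLDS**: the `Prop` `W4BandLaw` above.  Verbatim the
skeleton's statement (its content is the tree theorem `Census.w4BandLaw_holds`).  A registered stub SIGNATURE, not a literature fact. -/
def Stmt.stub_w4Band : Prop :=
    W4BandLaw

/-- `Stmt.stub_hardChambers` (registered stub `stub_hardChambers`) — **THE HARD CHAMBERS `[1, 954, 1706, 1709]` CARRY THE DOOR-A ROW,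
USING THE BAND LAW**: `W4BandLaw →` for each hard chamber and every support in it, `PosRootLawOn 2 6 19 d`.  Verbatim the skeleton's statement;
OPEN (the crux of the line).  A registered stub SIGNATURE, not a literature fact. -/
def Stmt.stub_hardChambers : Prop :=
    W4BandLaw → ∀ n ∈ [1, 954, 1706, 1709],
      ∀ d : Fin 6 → ℕ, StrictMono ((fun p : Fin 6 × Fin 6 => d p.1 + d p.2) ∘ chamber n) → PosRootLawOn 2 6 19 d

end Summit.ValiantsHypothesis.ValiantsHypothesis.Cruxes.DoorA26.Census
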